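import Summits.Ventures.HodgeRepro2.T5SU11KernelTwoSidedBound
import Summits.Ventures.HodgeRepro2.T5SU11KernelBracketEdge
import Summits.Ventures.HodgeRepro2.T5SU11KernelResolventIdentityEdge

/-!
# The two-sided ground-state bound at the edge, and its uniformity in the spectral parameter:
`|K_λ(t, s)| ≤ C Ξ(t) Ξ(s)` on `{max(t, s) ≥ a}` with ONE constant for ALL `λ > 1`

At the bottom of the spectrum the kernel is `K_1(t, s) = −Ξ(min(t, s)) χ_1(max(t, s))` (rows 480–481), and `χ_1(s) ≤ c e^{−s}`
on `[a, ∞)` (row 4xx's `χ_1 ≤ π e^{−t}` eventually, plus compactness), while `e^{−s} ≤ Ξ(s)` (row 600): hence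

  **`|K_1(t, s)| ≤ c Ξ(t) Ξ(s)` for `max(t, s) ≥ a`** (`exists_abs_kernel_one_le_mul_sph_one`),

and since **`K_1 ≤ K_λ ≤ 0`** for every `λ > 1` (row 5xx's `sphGreenKernel_one_le`: the edge kernel is the smallest Green's kernel),
the same constant serves every `λ > 1`:

* `exists_sphDecay_one_le_exp_of_le` — `χ_1(s) ≤ c e^{−s}` on `[a, ∞)`;
* `exists_abs_kernel_one_le_mul_sph_one` — the two-sided bound of the edge kernel on `{max(t, s) ≥ a}`;
* `abs_kernel_le_abs_kernel_one` — `|K_λ(t, s)| ≤ |K_1(t, s)|`;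
* `exists_abs_kernel_le_mul_sph_one_uniform_lam` — **`∃ C, ∀ λ > 1, ∀ t, s > 0, max(t, s) ≥ a → |K_λ(t, s)| ≤ C Ξ(t) Ξ(s)`**: row 600's
  constant can be taken INDEPENDENT of the spectral parameter, all the way down to the edge;
* `exists_kernel_source_le_mul_sph_one_uniform_lam` — the kernel sources `K_λ(·, s)`, `s ≥ a`, lie in `W_1` with a constant
  `C Ξ(s)` independent of `λ`.

Nothing is claimed about (N).

Blind lane: Mathlib + the HodgeRepro2 prefix only; no sorry; axioms ⊆ {propext, Classical.choice,
Quot.sound}.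
-/

namespace Summit.Ventures.HodgeRepro2.T5SU11KernelTwoSidedBoundEdge

open Filter Topology MeasureTheory
open Set (Ioi Ioc Icc)
open scoped Real
open T5SU11Cartan T5SU11SphericalFunction T5SU11SphericalBounds T5SU11SphericalDecay T5SU11SphericalDecayEdge
  T5SU11RadialGreenKernel T5SU11RadialGreenPositivity T5SU11KernelTwoSidedBound T5SU11KernelBracketEdge
  T5SU11KernelResolventIdentityEdge

section measure

variable [MeasurableSpace Circle] [BorelSpace Circle]

/-- **`χ_1(s) ≤ c e^{−s}` on `[a, ∞)`** for every `a > 0`. -/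
theorem exists_sphDecay_one_le_exp_of_le {a : ℝ} (ha : 0 < a) :
    ∃ c : ℝ, 0 < c ∧ ∀ s, a ≤ s → sphDecay 1 s ≤ c * Real.exp (-s) := by
  have hπ := Real.pi_pos
  obtain ⟨T₀, hT₀⟩ := eventually_atTop.mp eventually_sphDecay_one_le
  set T : ℝ := max T₀ a with hT
  have haT : a ≤ T := le_max_right _ _
  have hsub : Icc a T ⊆ Ioi 0 := fun s hs => lt_of_lt_of_le ha hs.1
  have hcont : ContinuousOn (sphDecay 1) (Icc a T) :=
    fun s hs => (hasDerivAt_sphDecay_one (hsub hs)).continuousAt.continuousWithinAt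
  obtain ⟨s₁, hs₁, hmax⟩ := isCompact_Icc.exists_isMaxOn (Set.nonempty_Icc.mpr haT) hcont
  have hχ : 0 < sphDecay 1 s₁ := sphDecay_one_pos (hsub hs₁)
  refine ⟨max π (sphDecay 1 s₁ * Real.exp T), lt_max_of_lt_left hπ, fun s hs => ?_⟩
  rcases le_or_gt T s with hTs | hTs
  · calc sphDecay 1 s ≤ π * Real.exp (-s) := hT₀ s (le_trans (le_max_left _ _) hTs)
      _ ≤ max π (sphDecay 1 s₁ * Real.exp T) * Real.exp (-s) :=
          mul_le_mul_of_nonneg_right (le_max_left _ _) (Real.exp_pos _).le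
  · have hs' : s ∈ Icc a T := ⟨hs, hTs.le⟩
    calc sphDecay 1 s ≤ sphDecay 1 s₁ := (isMaxOn_iff.mp hmax) s hs'
      _ = sphDecay 1 s₁ * Real.exp T * Real.exp (-T) := by
          rw [mul_assoc, ← Real.exp_add]
          simp
      _ ≤ sphDecay 1 s₁ * Real.exp T * Real.exp (-s) := by
          apply mul_le_mul_of_nonneg_left _ (mul_nonneg hχ.le (Real.exp_pos _).le)
          exact Real.exp_le_exp.mpr (by linarith)
      _ ≤ max π (sphDecay 1 s₁ * Real.exp T) * Real.exp (-s) :=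
          mul_le_mul_of_nonneg_right (le_max_right _ _) (Real.exp_pos _).le

/-- `|K_1(t, s)| = Ξ(min(t, s)) χ_1(max(t, s))` for `t > 0`. -/
theorem abs_sphGreenKernel_one_eq {t s : ℝ} (ht : 0 < t) :
    |sphGreenKernel 1 t s| = sph 1 (hyp (min t s)) * sphDecay 1 (max t s) := by
  have hmax : 0 < max t s := lt_max_of_lt_left ht
  unfold sphGreenKernel greenKernel
  rw [abs_neg, abs_of_pos (mul_pos (sph_hyp_pos 1 _) (sphDecay_one_pos hmax))]

/-- **The two-sided ground-state bound of the EDGE kernel**: `|K_1(t, s)| ≤ C Ξ(t) Ξ(s)` for `t, s > 0` with `max(t, s) ≥ a`. -/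
theorem exists_abs_kernel_one_le_mul_sph_one {a : ℝ} (ha : 0 < a) :
    ∃ C : ℝ, 0 < C ∧ ∀ t s, 0 < t → 0 < s → a ≤ max t s →
      |sphGreenKernel 1 t s| ≤ C * (sph 1 (hyp t) * sph 1 (hyp s)) := by
  obtain ⟨c, hc, hc'⟩ := exists_sphDecay_one_le_exp_of_le ha
  refine ⟨c, hc, fun t s ht hs hm => ?_⟩
  rw [abs_sphGreenKernel_one_eq ht]
  have hmax0 : 0 < max t s := lt_max_of_lt_left ht
  have hχ : sphDecay 1 (max t s) ≤ c * Real.exp (-(max t s)) := hc' _ hm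
  have hΞmax : Real.exp (-(max t s)) ≤ sph 1 (hyp (max t s)) := exp_neg_le_sph_one hmax0.le
  have hΞmin : 0 < sph 1 (hyp (min t s)) := sph_hyp_pos 1 _
  have e : sph 1 (hyp t) * sph 1 (hyp s) = sph 1 (hyp (min t s)) * sph 1 (hyp (max t s)) := by
    rcases le_total t s with hts | hst
    · rw [min_eq_left hts, max_eq_right hts]
    · rw [min_eq_right hst, max_eq_left hst, mul_comm]
  rw [e]
  calc sph 1 (hyp (min t s)) * sphDecay 1 (max t s)
      ≤ sph 1 (hyp (min t s)) * (c * Real.exp (-(max t s))) := mul_le_mul_of_nonneg_left hχ hΞmin.le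
    _ ≤ sph 1 (hyp (min t s)) * (c * sph 1 (hyp (max t s))) := by
        apply mul_le_mul_of_nonneg_left _ hΞmin.le
        exact mul_le_mul_of_nonneg_left hΞmax hc.le
    _ = c * (sph 1 (hyp (min t s)) * sph 1 (hyp (max t s))) := by ring

variable {lam : ℝ} (hlam : 1 < lam)

include hlam in
/-- **`|K_λ(t, s)| ≤ |K_1(t, s)|`**: the edge kernel dominates every Green's kernel (`K_1 ≤ K_λ ≤ 0`). -/
theorem abs_kernel_le_abs_kernel_one {t s : ℝ} (ht : 0 < t) (hs : 0 < s) :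
    |sphGreenKernel lam t s| ≤ |sphGreenKernel 1 t s| := by
  have h1 := sphGreenKernel_one_le hlam ht hs
  have h2 := sphGreenKernel_neg hlam (s := s) ht
  rw [abs_of_neg h2, abs_of_neg (lt_of_le_of_lt h1 h2)]
  linarith

/-- **THE TWO-SIDED BOUND WITH A CONSTANT INDEPENDENT OF THE SPECTRAL PARAMETER**: for every `a > 0` there is `C > 0` with
`|K_λ(t, s)| ≤ C Ξ(t) Ξ(s)` for ALL `λ > 1` and all `t, s > 0` with `max(t, s) ≥ a`. -/
theorem exists_abs_kernel_le_mul_sph_one_uniform_lam {a : ℝ} (ha : 0 < a) :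
    ∃ C : ℝ, 0 < C ∧ ∀ lam, 1 < lam → ∀ t s, 0 < t → 0 < s → a ≤ max t s →
      |sphGreenKernel lam t s| ≤ C * (sph 1 (hyp t) * sph 1 (hyp s)) := by
  obtain ⟨C, hC, hC'⟩ := exists_abs_kernel_one_le_mul_sph_one ha
  exact ⟨C, hC, fun lam hlam t s ht hs hm =>
    le_trans (abs_kernel_le_abs_kernel_one hlam ht hs) (hC' t s ht hs hm)⟩

/-- **The kernel sources `K_λ(·, s)`, `s ≥ a`, lie in `W_1` with a constant `C Ξ(s)` independent of `λ > 1`.** -/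
theorem exists_kernel_source_le_mul_sph_one_uniform_lam {a : ℝ} (ha : 0 < a) :
    ∃ C : ℝ, 0 < C ∧ ∀ lam, 1 < lam → ∀ s, a ≤ s → ∀ r, 0 < r →
      |sphGreenKernel lam r s| ≤ (C * sph 1 (hyp s)) * sph 1 (hyp r) := by
  obtain ⟨C, hC, hC'⟩ := exists_abs_kernel_le_mul_sph_one_uniform_lam ha
  refine ⟨C, hC, fun lam hlam s hs r hr => ?_⟩
  have hs0 : 0 < s := lt_of_lt_of_le ha hs
  calc |sphGreenKernel lam r s| ≤ C * (sph 1 (hyp r) * sph 1 (hyp s)) :=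
        hC' lam hlam r s hr hs0 (le_trans hs (le_max_right _ _))
    _ = (C * sph 1 (hyp s)) * sph 1 (hyp r) := by ring

end measure

end Summit.Ventures.HodgeRepro2.T5SU11KernelTwoSidedBoundEdge
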